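import Summits.CriticalPhenomena.PercolationContinuityZ3.Theorems.Transplant.FKConnectivityAllQAntipodalX2DualSem
import HarnessLib

/-!
# Connectivity correlation inequalities for `φ_{w,q}` — **the DUAL cross functional is nonnegative**: `X2∨ ≥ 0` on two-terminal
# series–parallel networks for every `q > 0` (the parallel twin of `FK.ApX2Pos`, by WORD DUALITY)

Theorem file (`--supports stmt-CriticalPhenomena-4575`), FK sub-lane `prim-bschramm-fk-2` (gen 14); builds on p205010 (kernel theorem,
internal audit signed; external expert review pending).  No definitions, no named facts, no sorries; standard axioms.

THE THEOREM (`FK.apX2Dual_nonneg_of_isTTSP`).  For `E` two-terminal series–parallel between `s, t`, `uv ∈ E`, `T ⊆ E ∖ uv`, `q > 0` and `g`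
monotone on the subsets of `T`: `0 ≤ apX2Dual q T s t u v g` (`…X2DualDefs`; memo g14 §5.6: the functional whose `(1-q)`-multiple completes
`q²·U_{M/z}` to the split up-correlation functional `U¹¹(y ∥ M)` of the parallel twin).  PROOF: along the spine of the marked edge the summand
factors through the DUAL WORD `(word C).map dualLetter` (kinds exchanged, bits complemented): `1{s↮t in C∪z} = lastP(row A)`,
`1{u↔v in (T∖C)∪st} = ¬headP(row B)`, and the weight is `dualCoef(w)·q^{expSum}` on the support (`…X2DualSem`); so
`apX2Dual = -∑_w dualCoef(w)·sSign(dual w)·fiberSum(w)` (`FK.IsSpine.apX2Dual_eq_sum_words`), and WORD-HALL (`FK.X2Word.sigma_wordHall`)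
applied to the dual words gives a bijection `ψ = dual ∘ Φ ∘ dual` from dual-losers to dual-winners which LOWERS the primal word by flips
`10 → 01`, hence `fiberSum(ψ w) ≤ fiberSum(w)` (Theorem U per flipped part, `FK.fiberSum_le_of_flip` read backwards) with `dualCoef(ψ w) = dualCoef(w)`:
the winner sum is dominated by the loser sum, which is the sign of `X2∨`.
[cite: Grimmett2006, §1.4 eq. (1.20) (p. 15); §3.9 (p. 63); §6.1 (pp. 133–136)]
-/

noncomputable section

namespace Summit.CriticalPhenomena.PercolationContinuityZ3.Theorems

namespace FK

open SimpleGraph Literature.Probability.LatticeModels Literature.Probability.Percolation X2Word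
open scoped Classical

variable {V : Type*}

/-! ### Invariances of the dual coefficient -/

/-- `onesCount` is symmetric under row exchange. [folklore] -/
theorem onesCount_map_swapLetter (w : List SLetter) : onesCount (w.map swapLetter) = onesCount w := by
  induction w with
  | nil => rfl
  | cons l w ih =>
    rw [List.map_cons, onesCount_cons, onesCount_cons, ih]
    obtain ⟨k, b, bb⟩ := l
    cases b <;> cases bb <;> simp [swapLetter]

/-- `seriesCount` is symmetric under row exchange. [folklore] -/
theorem seriesCount_map_swapLetter (w : List SLetter) : seriesCount (w.map swapLetter) = seriesCount w :=
  seriesCount_eq_of_map_fst_eq (by rw [List.map_map]; rfl)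

/-- Duality commutes with row exchange on words. [folklore] -/
theorem map_dualLetter_map_swapLetter (w : List SLetter) : (w.map swapLetter).map dualLetter = (w.map dualLetter).map swapLetter := by
  rw [List.map_map, List.map_map]
  exact List.map_congr_left fun l _ => dualLetter_swapLetter l

/-- The dual coefficient is symmetric under row exchange. [folklore] -/
theorem dualCoef_map_swapLetter (q : ℝ) (K L : ℕ) (w : List SLetter) : dualCoef q K L (w.map swapLetter) = dualCoef q K L w := by
  unfold dualCoef
  rw [onesCount_map_swapLetter, seriesCount_map_swapLetter, map_dualLetter_map_swapLetter, nP_map_swapLetter, sRuns_map_swapLetter]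

/-- The dual coefficient is positive (`q > 0`). [folklore] -/
theorem dualCoef_pos {q : ℝ} (hq : 0 < q) (K L : ℕ) (w : List SLetter) : 0 < dualCoef q K L w := by
  unfold dualCoef; exact div_pos (pow_pos hq _) (pow_pos hq _)

/-! ### `X2∨` as a signed sum over words -/

section Words

variable [Fintype V] {ps : List (SpinePart V)} {E T : Finset (Sym2 V)} {s t u v : V} {q : ℝ}

/-- **The summand of `X2∨` through the dual word.** [folklore] -/
theorem IsSpine.apX2Dual_summand (h : IsSpine ps {s(u, v)} u v E s t) (huv : u ≠ v) (hT : T ⊆ E.erase s(u, v)) (hq : 0 < q)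
    (g : Finset (Sym2 V) → ℝ) {C : Finset (Sym2 V)} (hC : C ⊆ T) :
    q ^ (clusterCount (↑(insert s(u, v) C) : BondConfig V) ∅ + clusterCount (↑(insert s(u, v) (T \ C)) : BondConfig V) ∅) *
        (q * apConn (insert s(u, v) (T \ C)) s t + (1 - apConn (insert s(u, v) (T \ C)) s t)) *
        ((1 - apConn (insert s(u, v) C) s t) * apConn (insert s(s, t) (T \ C)) u v * (g (T \ C) - g C)) =
      dualCoef q (Fintype.card V) ps.length (spineWord ps T C) * q ^ expSum ps T C *
        (((if lastP (sRowA ((spineWord ps T C).map dualLetter)) then (1 : ℝ) else 0) *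
          (1 - if headP (sRowB ((spineWord ps T C).map dualLetter)) then (1 : ℝ) else 0)) * (g (T \ C) - g C)) := by
  rw [h.dual_sign_A huv hT hC, h.dual_sign_B huv hT C, h.apConn_insert_marked_compl huv hT C]
  have hlast : lastP (sRowA ((spineWord ps T C).map dualLetter)) = !lastFlag true (sRowA (spineWord ps T C)) := by
    rw [sRowA_map_dualLetter, lastP_map_other]
  by_cases hA : lastFlag true (sRowA (spineWord ps T C)) = true
  · rw [hlast, hA]; simp
  · have hA' : lastFlag true (sRowA (spineWord ps T C)) = false := by simpa using hA
    have hN := h.dual_exponent_identity huv hT hC hA'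
    rw [hlast, hA']
    simp only [Bool.not_false, if_true, one_mul]
    -- the weight
    have key : q ^ (clusterCount (↑(insert s(u, v) C) : BondConfig V) ∅ +
        clusterCount (↑(insert s(u, v) (T \ C)) : BondConfig V) ∅) *
        (q * (if lastFlag true (sRowB (spineWord ps T C)) then (1 : ℝ) else 0) +
          (1 - if lastFlag true (sRowB (spineWord ps T C)) then (1 : ℝ) else 0)) =
        dualCoef q (Fintype.card V) ps.length (spineWord ps T C) * q ^ expSum ps T C := by
      have hne : q ^ (2 * (ps.length * Fintype.card V) + 2 * seriesCount (spineWord ps T C) +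
          sRuns ((spineWord ps T C).map dualLetter)) ≠ 0 := (pow_pos hq _).ne'
      rw [dualCoef, div_mul_eq_mul_div, eq_div_iff hne]
      by_cases hB : lastFlag true (sRowB (spineWord ps T C)) = true
      · rw [if_pos hB] at hN ⊢
        have e1 : q * (1 : ℝ) + (1 - 1) = q ^ 1 := by ring
        rw [e1, ← pow_add, ← pow_add, ← pow_add]
        congr 1; omega
      · rw [if_neg hB] at hN ⊢
        have e1 : q * (0 : ℝ) + (1 - 0) = q ^ 0 := by ring
        rw [e1, ← pow_add, ← pow_add, ← pow_add]
        congr 1; omega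
    calc _ = (q ^ (clusterCount (↑(insert s(u, v) C) : BondConfig V) ∅ +
          clusterCount (↑(insert s(u, v) (T \ C)) : BondConfig V) ∅) *
          (q * (if lastFlag true (sRowB (spineWord ps T C)) then (1 : ℝ) else 0) +
            (1 - if lastFlag true (sRowB (spineWord ps T C)) then (1 : ℝ) else 0))) *
          ((1 - if headP (sRowB (List.map dualLetter (spineWord ps T C))) then (1 : ℝ) else 0) * (g (T \ C) - g C)) := by ring
      _ = _ := by rw [key]

/-- **`X2∨ = -∑_w dualCoef(w) · sSign(dual w) · fiberSum(w)`.** [folklore] -/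
theorem IsSpine.apX2Dual_eq_sum_words (h : IsSpine ps {s(u, v)} u v E s t) (huv : u ≠ v) (hT : T ⊆ E.erase s(u, v)) (hq : 0 < q)
    (g : Finset (Sym2 V) → ℝ) :
    apX2Dual q T s t u v g = - ∑ w ∈ allWords ps,
      dualCoef q (Fintype.card V) ps.length w * sSign (w.map dualLetter) * fiberSum q ps T g w := by
  set K := Fintype.card V with hK
  set L := ps.length with hL
  unfold apX2Dual
  rw [Finset.sum_congr rfl (fun C hC => h.apX2Dual_summand huv hT hq g (Finset.mem_powerset.1 hC))]
  -- split `g(T∖C) - g(C)` and flip the first half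
  have hsplit : ∀ C ∈ T.powerset,
      dualCoef q K L (spineWord ps T C) * q ^ expSum ps T C *
        (((if lastP (sRowA ((spineWord ps T C).map dualLetter)) then (1 : ℝ) else 0) *
          (1 - if headP (sRowB ((spineWord ps T C).map dualLetter)) then (1 : ℝ) else 0)) * (g (T \ C) - g C)) =
      dualCoef q K L (spineWord ps T C) * q ^ expSum ps T C *
        ((if lastP (sRowA ((spineWord ps T C).map dualLetter)) then (1 : ℝ) else 0) *
          (1 - if headP (sRowB ((spineWord ps T C).map dualLetter)) then (1 : ℝ) else 0)) * g (T \ C) -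
      dualCoef q K L (spineWord ps T C) * q ^ expSum ps T C *
        ((if lastP (sRowA ((spineWord ps T C).map dualLetter)) then (1 : ℝ) else 0) *
          (1 - if headP (sRowB ((spineWord ps T C).map dualLetter)) then (1 : ℝ) else 0)) * g C := fun C _ => by ring
  rw [Finset.sum_congr rfl hsplit, Finset.sum_sub_distrib]
  have hflip : ∑ C ∈ T.powerset, dualCoef q K L (spineWord ps T C) * q ^ expSum ps T C *
        ((if lastP (sRowA ((spineWord ps T C).map dualLetter)) then (1 : ℝ) else 0) *
          (1 - if headP (sRowB ((spineWord ps T C).map dualLetter)) then (1 : ℝ) else 0)) * g (T \ C) =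
      ∑ C ∈ T.powerset, dualCoef q K L (spineWord ps T C) * q ^ expSum ps T C *
        ((if lastP (sRowA (((spineWord ps T C).map dualLetter).map swapLetter)) then (1 : ℝ) else 0) *
          (1 - if headP (sRowB (((spineWord ps T C).map dualLetter).map swapLetter)) then (1 : ℝ) else 0)) * g C := by
    rw [sum_powerset_flip T (fun C => dualCoef q K L (spineWord ps T C) * q ^ expSum ps T C *
        ((if lastP (sRowA ((spineWord ps T C).map dualLetter)) then (1 : ℝ) else 0) *
          (1 - if headP (sRowB ((spineWord ps T C).map dualLetter)) then (1 : ℝ) else 0)) * g (T \ C))]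
    refine Finset.sum_congr rfl fun C hC => ?_
    rw [Finset.mem_powerset] at hC
    rw [spineWord_sdiff ps hC, expSum_sdiff ps hC, Finset.sdiff_sdiff_eq_self hC, dualCoef_map_swapLetter,
      map_dualLetter_map_swapLetter]
  rw [hflip, ← Finset.sum_sub_distrib]
  -- group by words
  rw [← Finset.sum_fiberwise_of_maps_to (fun C _ => spineWord_mem_allWords ps T C), ← Finset.sum_neg_distrib]
  refine Finset.sum_congr rfl fun w _ => ?_
  unfold fiberSum
  rw [Finset.mul_sum, ← Finset.sum_neg_distrib]
  refine Finset.sum_congr rfl fun C hC => ?_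
  have hCw : spineWord ps T C = w := (Finset.mem_filter.1 hC).2
  rw [← cross_sub_cross_swap (w.map dualLetter), ← hCw]
  ring

end Words

/-! ### The theorem -/

section Main

variable [Fintype V] {ps : List (SpinePart V)} {E T : Finset (Sym2 V)} {s t u v : V} {q : ℝ}

/-- **`X2∨ ≥ 0` along a spine** for `g` monotone on the subsets of `T`: word duality + WORD-HALL + one Theorem U per flipped part, read
backwards (the matching is a bijection between dual losers and dual winners, so no sign condition on `g` is needed). [cite: Grimmett2006, §3.9 (p. 63)] -/
theorem IsSpine.apX2Dual_nonneg (h : IsSpine ps {s(u, v)} u v E s t) (huv : u ≠ v) (hT : T ⊆ E.erase s(u, v)) (hq : 0 < q)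
    {g : Finset (Sym2 V) → ℝ} (hg : ∀ ⦃A B : Finset (Sym2 V)⦄, A ⊆ B → B ⊆ T → g A ≤ g B) :
    0 ≤ apX2Dual q T s t u v g := by
  set K := Fintype.card V with hK
  set L := ps.length with hL
  set A := allWords ps with hA
  rw [h.apX2Dual_eq_sum_words huv hT hq g]
  -- the signed sum is (dual losers) minus (dual winners)
  have hsplit : ∑ w ∈ A, dualCoef q K L w * sSign (w.map dualLetter) * fiberSum q ps T g w =
      (∑ w ∈ A.filter (fun w => sIsWinner (w.map dualLetter) = true), dualCoef q K L w * fiberSum q ps T g w) -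
        ∑ w ∈ A.filter (fun w => sIsLoser (w.map dualLetter) = true), dualCoef q K L w * fiberSum q ps T g w := by
    rw [Finset.sum_filter, Finset.sum_filter, ← Finset.sum_sub_distrib]
    refine Finset.sum_congr rfl fun w _ => ?_
    unfold sSign
    split_ifs <;> ring
  rw [hsplit, neg_sub, sub_nonneg]
  -- data of the spine
  have hpw := h.pairwise_disjoint
  have hU := h.parts_isTTSP
  have hcov := h.cover_erase hT
  -- the map ψ = dual ∘ Φ ∘ dual on dual losers
  set ψ : List SLetter → List SLetter := fun w => (sigmaPhi (w.map dualLetter)).map dualLetter with hψ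
  have key : ∀ w ∈ A.filter (fun w => sIsLoser (w.map dualLetter) = true),
      dualCoef q K L (ψ w) * fiberSum q ps T g (ψ w) ≤ dualCoef q K L w * fiberSum q ps T g w ∧
        ψ w ∈ A.filter (fun w => sIsWinner (w.map dualLetter) = true) := by
    intro w hw
    rw [Finset.mem_filter] at hw
    obtain ⟨hwin, hruns, hfl, -⟩ := sigma_wordHall (w.map dualLetter) hw.2
    have hback := forall₂_flip_dual hfl
    have hψw : (ψ w).map dualLetter = sigmaPhi (w.map dualLetter) := map_dualLetter_map_dualLetter _
    have hkinds : (ψ w).map (·.1) = w.map (·.1) := by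
      have e1 := map_fst_eq_of_forall₂_flip hback
      rw [e1]
    have hmem : ψ w ∈ A := by
      rw [hA, mem_allWords_iff, hkinds, ← mem_allWords_iff]; exact hw.1
    have hcoef : dualCoef q K L (ψ w) = dualCoef q K L w := by
      unfold dualCoef
      rw [hψw, nP_eq_of_forall₂_flip hfl, hruns, onesCount_eq_of_forall₂_flip hback, seriesCount_eq_of_map_fst_eq hkinds]
    refine ⟨?_, Finset.mem_filter.2 ⟨hmem, by rw [hψw]; exact hwin⟩⟩
    rw [hcoef]
    exact mul_le_mul_of_nonneg_left (fiberSum_le_of_flip hq ps T g (ψ w) w hpw hU hcov hg hmem hback) (dualCoef_pos hq K L w).le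
  have hinj : ∀ w₁ ∈ A.filter (fun w => sIsLoser (w.map dualLetter) = true),
      ∀ w₂ ∈ A.filter (fun w => sIsLoser (w.map dualLetter) = true), ψ w₁ = ψ w₂ → w₁ = w₂ := by
    intro w₁ hw₁ w₂ hw₂ heq
    have e : ((sigmaPhi (w₁.map dualLetter)).map dualLetter).map dualLetter =
        ((sigmaPhi (w₂.map dualLetter)).map dualLetter).map dualLetter := by
      show (ψ w₁).map dualLetter = (ψ w₂).map dualLetter
      rw [heq]
    rw [map_dualLetter_map_dualLetter, map_dualLetter_map_dualLetter] at e
    have h2 := (sigma_wordHall _ (Finset.mem_filter.1 hw₂).2).2.2.2 _ (Finset.mem_filter.1 hw₁).2 e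
    have e2 := congrArg (List.map dualLetter) h2
    rw [map_dualLetter_map_dualLetter, map_dualLetter_map_dualLetter] at e2
    exact e2
  -- the image of ψ is all dual winners (same cardinality via the row exchange)
  have hsub : (A.filter (fun w => sIsLoser (w.map dualLetter) = true)).image ψ ⊆
      A.filter (fun w => sIsWinner (w.map dualLetter) = true) := by
    intro w hw
    obtain ⟨w₀, hw₀, rfl⟩ := Finset.mem_image.1 hw
    exact (key w₀ hw₀).2
  have hcard : (A.filter (fun w => sIsWinner (w.map dualLetter) = true)).card ≤
      ((A.filter (fun w => sIsLoser (w.map dualLetter) = true)).image ψ).card := by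
    rw [Finset.card_image_of_injOn (fun w₁ hw₁ w₂ hw₂ heq => hinj w₁ hw₁ w₂ hw₂ heq)]
    -- row exchange maps dual winners injectively into dual losers
    have hsw : (A.filter (fun w => sIsWinner (w.map dualLetter) = true)).image (fun w => w.map swapLetter) ⊆
        A.filter (fun w => sIsLoser (w.map dualLetter) = true) := by
      intro w hw
      obtain ⟨w₀, hw₀, rfl⟩ := Finset.mem_image.1 hw
      rw [Finset.mem_filter] at hw₀ ⊢
      refine ⟨?_, ?_⟩
      · rw [hA, mem_allWords_iff] at hw₀ ⊢
        rw [← hw₀.1, List.map_map]; rfl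
      · rw [map_dualLetter_map_swapLetter, sIsLoser_map_swapLetter]; exact hw₀.2
    have hswinj : Set.InjOn (fun w : List SLetter => w.map swapLetter)
        ↑(A.filter (fun w => sIsWinner (w.map dualLetter) = true)) := by
      intro w₁ _ w₂ _ heq
      have := congrArg (List.map swapLetter) heq
      simpa [List.map_map, Function.comp_def] using this
    calc (A.filter (fun w => sIsWinner (w.map dualLetter) = true)).card
        = ((A.filter (fun w => sIsWinner (w.map dualLetter) = true)).image (fun w => w.map swapLetter)).card :=
          (Finset.card_image_of_injOn hswinj).symm
      _ ≤ (A.filter (fun w => sIsLoser (w.map dualLetter) = true)).card := Finset.card_le_card hsw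
  have himage : (A.filter (fun w => sIsLoser (w.map dualLetter) = true)).image ψ =
      A.filter (fun w => sIsWinner (w.map dualLetter) = true) := Finset.eq_of_subset_of_card_le hsub hcard
  calc ∑ w ∈ A.filter (fun w => sIsWinner (w.map dualLetter) = true), dualCoef q K L w * fiberSum q ps T g w
      = ∑ w ∈ (A.filter (fun w => sIsLoser (w.map dualLetter) = true)).image ψ, dualCoef q K L w * fiberSum q ps T g w := by
        rw [himage]
    _ = ∑ w ∈ A.filter (fun w => sIsLoser (w.map dualLetter) = true), dualCoef q K L (ψ w) * fiberSum q ps T g (ψ w) := by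
        rw [Finset.sum_image hinj]
    _ ≤ ∑ w ∈ A.filter (fun w => sIsLoser (w.map dualLetter) = true), dualCoef q K L w * fiberSum q ps T g w :=
        Finset.sum_le_sum fun w hw => (key w hw).1

omit [Fintype V] in
/-- `X2∨` is symmetric in the marked pair. [folklore] -/
theorem apX2Dual_swap (q : ℝ) (T : Finset (Sym2 V)) (s t u v : V) (g : Finset (Sym2 V) → ℝ) :
    apX2Dual q T s t v u g = apX2Dual q T s t u v g := by
  unfold apX2Dual
  refine Finset.sum_congr rfl fun B _ => ?_
  rw [Sym2.eq_swap (a := v) (b := u)]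
  unfold apConn
  simp only [SimpleGraph.reachable_comm (u := v) (v := u)]

/-- **THEOREM (`X2∨ ≥ 0` on two-terminal series–parallel networks, every `q > 0`).**  For `E` two-terminal series–parallel between `s, t`, a
marked edge `uv ∈ E`, `T ⊆ E ∖ uv`, `q > 0` and `g` monotone on the subsets of `T`: `0 ≤ apX2Dual q T s t u v g` — the parallel twin of
`FK.apX2_nonneg_of_isTTSP`, by word duality (memo g14 §5.6). [cite: Grimmett2006, §3.9 (p. 63); §6.1 (pp. 133–136)] -/
theorem apX2Dual_nonneg_of_isTTSP (hq : 0 < q) (hE : IsTTSP E s t) (huv : s(u, v) ∈ E) (hT : T ⊆ E.erase s(u, v))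
    {g : Finset (Sym2 V) → ℝ} (hg : ∀ ⦃A B : Finset (Sym2 V)⦄, A ⊆ B → B ⊆ T → g A ≤ g B) :
    0 ≤ apX2Dual q T s t u v g := by
  have hne : u ≠ v := fun h => hE.not_isDiag huv (Sym2.mk_isDiag_iff.2 h)
  obtain ⟨ps, hsp | hsp⟩ := exists_spine hE huv
  · exact hsp.apX2Dual_nonneg hne hT hq hg
  · rw [← apX2Dual_swap]
    rw [Sym2.eq_swap] at hsp hT
    exact hsp.apX2Dual_nonneg hne.symm hT hq hg

end Main

end FK

end Summit.CriticalPhenomena.PercolationContinuityZ3.Theorems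

end
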